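import Mathlib
import HarnessLib
import Summits.HodgeConjecture.HodgeConjecture.Theses.GenericDivisibility
import Literature.AlgebraicGeometry.Motives.UnramifiedCohomology
import Literature.AlgebraicGeometry.HodgeTheory.BettiTorsionDiesGenerically
import Literature.AlgebraicGeometry.Resolution.ResolutionOfSingularities

/-!
# Sketch — crux-ideate stmt-HodgeConjecture-18467 (GenericDivisibilityBounded = C2), ideator k=2

First lemmas of the two idea cards, stated over existing declarations. Proofs are not required at
this stage (`sorry`); the file must elaborate.
-/

namespace Summit.HodgeConjecture.HodgeConjecture.Cruxes.GenericDivisibilityBounded.Sketch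

open Literature.AlgebraicGeometry.Motives Literature.AlgebraicGeometry.HodgeTheory
  Literature.AlgebraicTopology.SingularHomology

noncomputable section

/-- The crux at a fixed `(p, X)`: C2 restricted to one smooth projective `2p`-fold. -/
def C2At (p : ℕ) (X : SchemeOver ℂ) : Prop :=
  ∀ z : singularCohomology ℤ ℤ (ComplexPoints X) (2 * p),
    (∀ m : ℕ, 1 ≤ m → ∃ Z : Set X.left, IsClosed Z ∧ Z ≠ Set.univ ∧
      ∃ y : singularCohomology ℤ ℤ (complexPointsCompl X Z) (2 * p),
        m • y = singularCohomology.map ℤ ℤ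
          (⟨Subtype.val, continuous_subtype_val⟩ : C(complexPointsCompl X Z, ComplexPoints X))
          (2 * p) z) →
    singularCohomology.ringChange (Int.castRingHom ℂ) (ComplexPoints X) (2 * p) z ∈
      supportedClasses X (2 * p) 1

/-- Sanity: the route decl is literally `∀ p X, 1 ≤ p → IsSmoothProjective (2p) X → C2At p X`. -/
theorem genericDivisibilityBounded_iff :
    Theses.GenericDivisibility.GenericDivisibilityBounded ↔
      ∀ ⦃p : ℕ⦄ ⦃X : SchemeOver ℂ⦄, 1 ≤ p → IsSmoothProjective (2 * p) X → C2At p X :=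
  Iff.rfl

/-! ## Card 1 — one ordinary prime -/

/-- `Q(X)[ℓ] = 0` ("mod-`ℓ` coniveau one lifts"): an integral class of degree `2p` whose reduction
mod `ℓ` has coniveau `≥ 1` with `ℤ/ℓ`-coefficients is, modulo `ℓ • H^{2p}(X(ℂ); ℤ)`, an integral class
of integral coniveau `≥ 1`. -/
def ModPrimeConiveauLifts (ℓ p : ℕ) (X : SchemeOver ℂ) : Prop :=
  ∀ z : singularCohomology ℤ ℤ (ComplexPoints X) (2 * p),
    singularCohomology.ringChange (Int.castRingHom (ZMod ℓ)) (ComplexPoints X) (2 * p) z ∈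
        coniveauFiltration (ZMod ℓ) X (2 * p) 1 →
      ∃ w n : singularCohomology ℤ ℤ (ComplexPoints X) (2 * p),
        n ∈ coniveauFiltration ℤ X (2 * p) 1 ∧ z = ℓ • w + n

/-- **First lemma of card 1 (one prime suffices).** Granted the Bloch–Kato shadow
(torsion dies generically, CT–Voisin Thm 3.1 = the route's support item), `Q(X)[ℓ] = 0` for a single
prime `ℓ` implies C2 at `X`: the division lemma `z = ℓ w + n ⇒ w again generically divisible by every
m` iterates to `z̄ ∈ ⋂ₖ ℓᵏ (H/N¹) ⊆ torsion`, so `e • z ∈ N¹ H^{2p}(X(ℂ); ℤ)` and `z_ℂ ∈ N¹`. -/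
theorem onePrime_suffices (hT : ColliotTheleneVoisin2012_torsionDiesGenerically) :
    ∀ ⦃p : ℕ⦄ ⦃X : SchemeOver ℂ⦄, 1 ≤ p → IsSmoothProjective (2 * p) X →
      (∃ ℓ : ℕ, ℓ.Prime ∧ ModPrimeConiveauLifts ℓ p X) → C2At p X := by
  sorry

/-- The TRANSFER target C2⁺ of card 1: every smooth projective `2p`-fold has at least one prime `ℓ`
with `Q(X)[ℓ] = 0`. With `onePrime_suffices` it implies the crux. -/
def OnePrimeEverywhere : Prop :=
  ∀ ⦃p : ℕ⦄ ⦃X : SchemeOver ℂ⦄, 1 ≤ p → IsSmoothProjective (2 * p) X →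
    ∃ ℓ : ℕ, ℓ.Prime ∧ ModPrimeConiveauLifts ℓ p X

theorem genericDivisibilityBounded_of_onePrimeEverywhere
    (hT : ColliotTheleneVoisin2012_torsionDiesGenerically) (h : OnePrimeEverywhere) :
    Theses.GenericDivisibility.GenericDivisibilityBounded := by
  intro p X hp hX
  exact onePrime_suffices hT hp hX (h hp hX)

/-- The DICHOTOMY step of card 1 in pure linear algebra (the form in which Bloch–Esnault
non-vanishing + residual monodromy irreducibility deliver `Q[ℓ] = 0`): inside
`V = H^{2p}(X(ℂ); ℤ/ℓ)` let `N` be the mod-`ℓ` coniveau-one subspace, `N₀ ≤ N` the reduction of the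
integral coniveau-one lattice, `P` a complement of `N₀` (the primitive part mod `ℓ`) on which a set
`G` of linear symmetries of `(V, N)` acts irreducibly; if `N ≠ ⊤` then `N = N₀`. -/
theorem dichotomy {K V : Type*} [Field K] [AddCommGroup V] [Module K V]
    (N N₀ P : Submodule K V) (hN₀ : N₀ ≤ N) (hcompl : IsCompl N₀ P)
    (G : Set (V →ₗ[K] V)) (hGN : ∀ g ∈ G, N.map g ≤ N) (hGP : ∀ g ∈ G, P.map g ≤ P)
    (hirr : ∀ W : Submodule K V, W ≤ P → (∀ g ∈ G, W.map g ≤ W) → W = ⊥ ∨ W = P)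
    (hBE : N ≠ ⊤) : N = N₀ := by
  sorry


/-- The PERIOD CRITERION — the shape in which the Bloch–Kato–Esnault ordinary mod-`p` period maps enter
(card `ordinary-prime-periods`): inside `V = H^{2p}(X(ℂ); ℤ/p)` let `N` be the mod-`p` coniveau-one subspace,
`N₀ ≤ N` the reduction of the integral coniveau-one lattice and `P` a complement of `N₀` (the transcendental
lattice mod `p`). If a family `F` of linear functionals (the unit-root period maps `g ∘ α_𝔭`, `𝔭 ∣ p` ordinary,
`g` Galois) kills `N` and has no common zero on `P`, then `N = N₀`, i.e. `Q(X)[p] = 0`. -/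
theorem periodCriterion {K V : Type*} [Field K] [AddCommGroup V] [Module K V]
    (N N₀ P : Submodule K V) (hN₀ : N₀ ≤ N) (hcompl : IsCompl N₀ P)
    (F : Set (V →ₗ[K] K)) (hFN : ∀ f ∈ F, N ≤ LinearMap.ker f)
    (hFP : P ⊓ (⨅ f ∈ F, LinearMap.ker f) = ⊥) : N = N₀ := by
  sorry

/-- How `periodCriterion` feeds `ModPrimeConiveauLifts`: if the mod-`p` coniveau-one subspace equals the
reduction of the integral one, then mod-`p` coniveau lifts (the kernel of reduction mod `p` is `p • H`). -/
theorem modPrimeConiveauLifts_of_eq (p' q : ℕ) (X : SchemeOver ℂ)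
    (h : coniveauFiltration (ZMod p') X (2 * q) 1 =
      Submodule.span (ZMod p')
        (Set.range fun n : coniveauFiltration ℤ X (2 * q) 1 =>
          singularCohomology.ringChange (Int.castRingHom (ZMod p')) (ComplexPoints X) (2 * q) n.1)) :
    ModPrimeConiveauLifts p' q X := by
  sorry

/-! ## Card 2 — linking with the torsion of divisors (topological dual) -/

/-- Extension defect bounded by `e`: whenever `m • y` extends from a non-empty Zariski open to `X`,
`e • y` itself extends after shrinking the open. (`e = 1` is `Q(X)_tors = 0`; `∃ e` is
`exp Q(X)_tors ∣ e`.) By Alexander–Lefschetz duality the obstruction to extending `y` is the torsion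
class `∂y ∈ H^{2p+1}_Z(X;ℤ)[m] ≅ H_{2p-1}(Z(ℂ);ℤ)[m]`, and "after shrinking" kills exactly the torsion
that dies on a larger divisor. -/
def ExtensionDefectLe (e p : ℕ) (X : SchemeOver ℂ) : Prop :=
  ∀ (Z : Set X.left), IsClosed Z → Z ≠ Set.univ →
    ∀ (y : singularCohomology ℤ ℤ (complexPointsCompl X Z) (2 * p)) (m : ℕ), 1 ≤ m →
      ∀ z : singularCohomology ℤ ℤ (ComplexPoints X) (2 * p),
        m • y = singularCohomology.map ℤ ℤ
          (⟨Subtype.val, continuous_subtype_val⟩ : C(complexPointsCompl X Z, ComplexPoints X))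
          (2 * p) z →
        ∃ (Z' : Set X.left) (h : Z ⊆ Z'), IsClosed Z' ∧ Z' ≠ Set.univ ∧
          ∃ w : singularCohomology ℤ ℤ (ComplexPoints X) (2 * p),
            singularCohomology.map ℤ ℤ
                (⟨Subtype.val, continuous_subtype_val⟩ :
                  C(complexPointsCompl X Z', ComplexPoints X)) (2 * p) w =
              e • singularCohomology.map ℤ ℤ (complexPointsComplInclusion h) (2 * p) y

/-- **First lemma of card 2.** A bounded extension defect along the witnesses gives C2 at `X`
(then `e • z ∈ m • H + N¹(ℤ)` for every `m`, and subgroups of the finitely generated group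
`H^{2p}(X(ℂ); ℤ)/N¹` are closed in the profinite topology). -/
theorem c2At_of_extensionDefectLe :
    ∀ ⦃p : ℕ⦄ ⦃X : SchemeOver ℂ⦄, 1 ≤ p → IsSmoothProjective (2 * p) X →
      (∃ e : ℕ, 1 ≤ e ∧ ExtensionDefectLe e p X) → C2At p X := by
  sorry

/-! ## Card 3 — birational SNC descent -/

/-- **First lemma of card `birational-snc-descent`: the crux is a birational statement.** For a
birational morphism between smooth projective `2p`-folds (e.g. a composite of blow-ups in smooth
centres), C2 at `X` and C2 at `X'` are equivalent: non-empty Zariski opens correspond cofinally over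
the isomorphism locus, exceptional classes have coniveau `≥ 1`, and `π^*`/`π_*` preserve `N¹ ⊗ ℚ`.
Consequently every witness divisor may be assumed simple-normal-crossing with smooth components
(Hironaka, embedded resolution), and `Q(X) = H^{2p}_nr/H^{2p}` is a birational invariant. -/
theorem c2At_birational_invariant :
    ∀ ⦃p : ℕ⦄ ⦃X X' : SchemeOver ℂ⦄ (π : X' ⟶ X), 1 ≤ p →
      IsSmoothProjective (2 * p) X → IsSmoothProjective (2 * p) X' →
      Literature.AlgebraicGeometry.Resolution.IsBirational π.left →
      (C2At p X ↔ C2At p X') := by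
  sorry

end

end Summit.HodgeConjecture.HodgeConjecture.Cruxes.GenericDivisibilityBounded.Sketch
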